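import Mathlib
import Summits.KontsevichZagierPeriods.Zeta5Search.ClusterValuationResidues
import Summits.KontsevichZagierPeriods.Zeta5Search.DualSeriesScaling
import HarnessLib

/-!
# G8 ClusterValuation addendum (gen-2 g8): the mechanism of (V-floor) and the class pieces of the `𝒦`-bracket

HONEST FRAMING: systematic search; no irrationality claim unless certified.  Statements about `p`-adic valuations of rational
numbers attached to the auxiliary forms of the ζ(5) search; nothing here concerns irrationality.

STAGED for the typer (LEAN PLACEMENT `Zeta5Search/ClusterValuation*.lean`, e.g. `ClusterValuationPairs.lean`); imports the landed
`ClusterValuation` (§1–§3) and `ClusterValuationResidues` (§4).  Contents (REPORT-gen2-g8 §2–§3):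
* §3b the MECHANISM of (V-floor): `conjClass`, `ClassExpLowerBound` (E_x ≥ −N_p−1 for multipole classes), `ClassExpRigidity` (equality only for
  two simple / two double poles, never self-conjugate), `PairCancellation` (conjugate extremal classes cancel their leading digits) — together with
  `ClassVBound`, `ZeroEvaluation` and `SinglePoleExpBound` they PROVE (paper) `ConstantTermFloorLaw` in the window `5 ≤ p ≤ b₀ < p² − 2`;
* §3c the CLASS PIECES OF `𝒦_p`: `classK`, the PROVED regroupings `coeffV_eq_sum_classV`, `kRes_eq_sum_classK`, and the statements that locate the
  remaining proof debt of (CV): `SinglePoleClassKBound` (v ≥ 1), `MultipoleClassKBound` (v ≥ 3 + E_x), `SymmetricClassKBound` (Lemma S: v ≥ 4 + E_x for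
  shapes (−a,−a), a ≥ 2), `SingleRowLaw` (PROVED on paper from A′ + Theorem V), `MultiBlockLaw` (OBSERVED; = the whole residual content of (CV-𝒦));
* §3d `#guard` cross-checks.
Exact checks: g8 scripts v1v4_check.py (18,695 classes / 238 extremal), blocklaw.py (1,802 window pairs: MB 1,802/1,802, SR 20,606 rows, Lemma S 1,018,
`v(𝒦_x) ≥ 3+E_x` 12,173, single `v(𝒦_x) ≥ 1` 20,606), exhaustive n ≤ 13 (exh_val.py) and n ≤ 24 (exh_comb.py) enumerations — see REPORT-gen2-g8 §3.6.
-/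

open Finset
open Summit.KontsevichZagierPeriods.Zeta5Search.WedgeDictionary (coeffW coeffV pfData dOf)
open Summit.KontsevichZagierPeriods.Zeta5Search.CasoratianValuation (InPolytope pairFloors refund shift casoratian CasoratianValuationLaw)

namespace Summit.KontsevichZagierPeriods.Zeta5Search.ClusterValuation

/-! ### §3b (g8) The mechanism of (V-floor): class exponents vs pair floors, and conjugate-pair cancellation

(REPORT-gen2-g8 §2.)  (V-floor) (`ConstantTermFloorLaw`, §4) is NOT classwise: `v_p(V) = min_x v_p(V_x)` fails in ≈15 % of the window
pairs `(b,p)`.  The exact mechanism, which PROVES (V-floor) in the window on paper from Theorems A/B, ZeroEvaluation and the floor facts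
(F1)/(F2) of the (T1) proof:
(i) `E_x ≥ −N_p − 1` for every class with ≥ 2 poles (counting; corollary of (F1)/(F2)), with equality ONLY for the two FULL-RIGID shapes —
the class consists of exactly two points, both simple poles (then `N_p = 1`) or both double poles (then `N_p = 3`) — and a full-rigid class
is never self-conjugate (`ClassExpLowerBound`, `ClassExpRigidity`);
(ii) `v_p(V_x) ≥ E_x` for every pole class (Theorem A termwise: only the harmonic terms `k = p·m` lose `p^{o+1}`), `v_p(V_x) ≥ 0` under
ZeroEvaluation, and a single-pole class with a neutral point below its pole has `E_x ≥ −N_p` (by (F1): `N_{1k} ≥ 1` for the `s` blocks above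
`B_1` containing the pole);
(iii) for a full-rigid class the leading digits of `V_x` and of its CONJUGATE class `x̄ ∋ b₀ − x` cancel (`PairCancellation`):
`digit_E(V_x) = (−1)^E ḡ_x 𝒱 p^E` with the shape constants `𝒱 = −1` (two simple poles) resp. `3` (two double poles), the same for `x̄`,
and `ḡ_x̄ ≡ (−1)^{E+1} ḡ_x (mod p)` from the reflection `y ↦ −y − b₀` under which `R_b` is odd (`E` is even for both shapes).
(i)–(iii) ⇒ (V-floor) for `5 ≤ p ≤ b₀ < p² − 2`.  Exact check (`g8/v1v4_check.py`, 458 vectors, `b₀ ≤ 70`): (i) 18,695 multipole classes,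
0 failures, equality 238× (166 + 72 by shape, always two points, never self-conjugate); (iii) 238/238, with `v_p(V_x) = E_x` exactly in
all 238 (so the cancellation is genuinely needed). -/

/-- The conjugate class of `x` (for `x < p ≤ b₀`): the class of `b₀ − x`, image of the class of `x` under the reflection `q ↦ b₀ − q`. -/
def conjClass (b : ℕ → ℤ) (p x : ℕ) : ℕ := ((b 0).toNat - x) % p

/-- **CLASS EXPONENT LOWER BOUND (g8; PROVED on paper from (F1)/(F2), REPORT-gen2-g8 §2.2)**: a class with at least two poles has
`E_x ≥ −(N_p + 1)`.  (Only `p` odd `≥ 5` is used, as in (T1).) -/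
@[conjecture] def ClassExpLowerBound : Prop :=
  ∀ (b : ℕ → ℤ) (p x : ℕ), InPolytope b → 5 ≤ p → ¬ 2 ∣ p → (p : ℤ) ≤ b 0 → (b 0 + 2 : ℤ) < (p : ℤ) ^ 2 → x < p →
    2 ≤ classPoleCount b p x → -(pairFloors b p + 1) ≤ classExp b p x

/-- **RIGIDITY OF THE EXTREMAL CLASSES (g8; PROVED on paper, REPORT-gen2-g8 §2.2)**: equality `E_x = −(N_p+1)` forces the class to consist of
exactly two points, both simple poles (`N_p = 1`) or both double poles (`N_p = 3`), and `x̄ ≠ x`. -/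
@[conjecture] def ClassExpRigidity : Prop :=
  ∀ (b : ℕ → ℤ) (p x : ℕ), InPolytope b → 5 ≤ p → ¬ 2 ∣ p → (p : ℤ) ≤ b 0 → (b 0 + 2 : ℤ) < (p : ℤ) ^ 2 → x < p →
    2 ≤ classPoleCount b p x → classExp b p x = -(pairFloors b p + 1) →
      (classSet b p x).card = 2 ∧ conjClass b p x ≠ x ∧
        ((pairFloors b p = 1 ∧ ∀ q ∈ classSet b p x, netExp b q = -1) ∨
         (pairFloors b p = 3 ∧ ∀ q ∈ classSet b p x, netExp b q = -2))

/-- **CONJUGATE-PAIR CANCELLATION (g8; first-digit identity, PROVED on paper modulo Theorem B, REPORT-gen2-g8 §2.3; exact check 238/238)**: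
for an extremal class the `p^{E_x}`-digits of `V_x` and `V_x̄` cancel, so `v_p(V_x + V_x̄) ≥ E_x + 1 = −N_p`. -/
@[conjecture] def PairCancellation : Prop :=
  ∀ (b : ℕ → ℤ) (p x : ℕ), InPolytope b → p.Prime → 5 ≤ p → (p : ℤ) ≤ b 0 → (b 0 + 2 : ℤ) < (p : ℤ) ^ 2 → x < p →
    2 ≤ classPoleCount b p x → classExp b p x = -(pairFloors b p + 1) →
      classV b p x + classV b p (conjClass b p x) ≠ 0 →
        -pairFloors b p ≤ padicValRat p (classV b p x + classV b p (conjClass b p x))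

/-- **SINGLE-POLE CLASS EXPONENT BOUND (g8 Lemma V2, PROVED on paper from (F1))**: a class with exactly one pole `q` (order `s = −netExp q`)
and a NEUTRAL point below it has `−N_p ≤ −s`, hence `v(V_x) ≥ −s ≥ −N_p` by Theorem A′. -/
@[conjecture] def SinglePoleExpBound : Prop :=
  ∀ (b : ℕ → ℤ) (p x q s₀ : ℕ), InPolytope b → 5 ≤ p → ¬ 2 ∣ p → (p : ℤ) ≤ b 0 → (b 0 + 2 : ℤ) < (p : ℤ) ^ 2 → x < p →
    classPoleCount b p x = 1 → q ∈ classSet b p x → netExp b q < 0 → s₀ ∈ classSet b p x → s₀ < q → netExp b s₀ = 0 →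
      netExp b q ≥ -pairFloors b p

/-! ### §3c (NEW, g8) The class pieces of `𝒦_p` and the location of the (CV) proof debt

`𝒦_p = Σ_x 𝒦_x`, `V = Σ_y V_y` (PROVED regroupings below), so the `𝒦`-bracket of `casoratian_split` is `B = Σ_{x,y} B_{xy}`,
`B_{xy} = 𝒦_x(b⁺)V_y(b) − 𝒦_x(b)V_y(b⁺)`.  Valuations of the pieces: `v(𝒦_x) ≥ 1` for a single-pole class (Theorem A′ and `p ∣ g_o(k) − [o=2]`,
`p² ∣ g_0(k)`), `v(𝒦_x) ≥ 3 + E_x` for every pole class (Theorem A), and `v(𝒦_x) ≥ 4 + E_x` for the symmetric two-point shapes `(−a,−a)`, `a ≥ 2`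
(Lemma S: the first 𝒦-digit `2ρ_{1,2} + ρ_{1,1} = (−1)^b C(a+b−3,b−2)(b−a)/(b−1)` vanishes iff `a = b`).  Consequently the single-pole ROWS
`Σ_y B_{xy}` carry the refund (`SingleRowLaw`, PROVED on paper from Theorem V), and the whole residual content of (CV-𝒦) is the block over pairs of
MULTIPOLE classes (`MultiBlockLaw`, OBSERVED: 1,802/1,802 window pairs + exhaustive n ≤ 13; REPORT-gen2-g8 §3 classifies where its terms must
cancel: two-point classes, need ≤ 4 digits, first digit in closed form). -/

/-- `𝒦_x := Σ_{q ∈ class x} Σ_o c_{o,q} (g_o(q+1) − [o=2])`, the class-`x` piece of `kRes`. -/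
noncomputable def classK (b : ℕ → ℤ) (p x : ℕ) : ℚ :=
  ∑ q ∈ classSet b p x, ∑ o ∈ range 6,
    pfData b o q * ((taylorTT p o ((q : ℤ) + 1) : ℚ) - if o = 2 then 1 else 0)

/-- Regrouping a sum over the positions `0..b₀` by residue classes modulo `p > 0`. -/
theorem sum_classSet_eq (b : ℕ → ℤ) {p : ℕ} (hp : 0 < p) (F : ℕ → ℚ) :
    ∑ x ∈ range p, ∑ q ∈ classSet b p x, F q = ∑ q ∈ range ((b 0).toNat + 1), F q := by
  have h1 : ∀ x ∈ range p, classSet b p x = (range ((b 0).toNat + 1)).filter (fun s => s % p = x) := by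
    intro x hx
    rw [Finset.mem_range] at hx
    simp only [classSet, Nat.mod_eq_of_lt hx]
  rw [Finset.sum_congr rfl (fun x hx => by rw [h1 x hx])]
  exact Finset.sum_fiberwise_of_maps_to (fun q _ => Finset.mem_range.mpr (Nat.mod_lt q hp)) F

/-- **`V = Σ_x V_x`** (PROVED). -/
theorem coeffV_eq_sum_classV (b : ℕ → ℤ) {p : ℕ} (hp : 0 < p) : coeffV b = ∑ x ∈ range p, classV b p x := by
  unfold classV
  rw [sum_classSet_eq b hp, coeffV, Finset.sum_comm]

/-- **`𝒦_p = Σ_x 𝒦_x`** (PROVED). -/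
theorem kRes_eq_sum_classK (b : ℕ → ℤ) {p : ℕ} (hp : 0 < p) : kRes b p = ∑ x ∈ range p, classK b p x := by
  unfold classK
  rw [sum_classSet_eq b hp, kRes, Finset.sum_comm]

/-- **SINGLE-POLE CLASSES: `v(𝒦_x) ≥ 1`** (PROVED on paper: Theorem A′ + `p ∣ g_o(q+1) − [o=2]`; g8 check 20,606 classes (for `b` and `(t+c)²R_b`)). -/
@[conjecture] def SinglePoleClassKBound : Prop :=
  ∀ (b : ℕ → ℤ) (p x : ℕ), InPolytope b → p.Prime → 5 ≤ p → (b 0 + 2 : ℤ) < (p : ℤ) ^ 2 → x < p →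
    classPoleCount b p x = 1 → classK b p x ≠ 0 → 1 ≤ padicValRat p (classK b p x)

/-- **POLE CLASSES: `v(𝒦_x) ≥ 3 + E_x`** (PROVED on paper: Theorem A + `p² ∣ g_0`, `p ∣ g_o − [o=2]`; g8 check 12,173 multipole classes). -/
@[conjecture] def MultipoleClassKBound : Prop :=
  ∀ (b : ℕ → ℤ) (p x : ℕ), InPolytope b → p.Prime → 5 ≤ p → (b 0 + 2 : ℤ) < (p : ℤ) ^ 2 → x < p →
    1 ≤ classPoleCount b p x → classK b p x ≠ 0 → 3 + classExp b p x ≤ padicValRat p (classK b p x)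

/-- **LEMMA S (g8, PROVED on paper modulo Theorem B; closed form): for a two-point class of shape `(−a,−a)`, `a ≥ 2`, not self-conjugate,
the first `𝒦`-digit vanishes: `v(𝒦_x) ≥ 4 + E_x`** (g8 check 1,018 classes + exhaustive n ≤ 13). -/
@[conjecture] def SymmetricClassKBound : Prop :=
  ∀ (b : ℕ → ℤ) (p x : ℕ) (a : ℤ), InPolytope b → p.Prime → 5 ≤ p → (p : ℤ) ≤ b 0 → (b 0 + 2 : ℤ) < (p : ℤ) ^ 2 → x < p →
    (classSet b p x).card = 2 → (∀ q ∈ classSet b p x, netExp b q = -a) → 2 ≤ a → ¬ CentreIn b p x →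
      classK b p x ≠ 0 → 4 + classExp b p x ≤ padicValRat p (classK b p x)

/-- **SINGLE-POLE ROWS CARRY THE REFUND (g8 §3.1(a), PROVED on paper from `SinglePoleClassKBound` and THEOREM V = (V-floor) for `b` and `b⁺`)**:
`v(𝒦_x(b⁺)V(b) − 𝒦_x(b)V(b⁺)) ≥ 1 − N_p(b)` for every single-pole class `x` (g8 check 20,606 rows + exhaustive n ≤ 13). -/
@[conjecture] def SingleRowLaw : Prop :=
  ∀ (b : ℕ → ℤ) (j p x : ℕ), InPolytope b → 1 ≤ j → j ≤ 7 → InPolytope (shift b j) →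
    p.Prime → 5 ≤ p → (b 0 + 2 : ℤ) < (p : ℤ) ^ 2 → x < p → classPoleCount b p x = 1 →
      classK (shift b j) p x * coeffV b - classK b p x * coeffV (shift b j) ≠ 0 →
        1 - pairFloors b p ≤ padicValRat p (classK (shift b j) p x * coeffV b - classK b p x * coeffV (shift b j))

/-- The set of MULTIPOLE classes of `b` modulo `p`. -/
def multipoleClasses (b : ℕ → ℤ) (p : ℕ) : Finset ℕ := (range p).filter fun x => 2 ≤ classPoleCount b p x

/-- **MULTI–MULTI BLOCK LAW (g8 §3, OBSERVED: 1,802/1,802 window pairs, exhaustive n ≤ 13; tight in the cancellation regime)**: the block of the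
`𝒦`-bracket over pairs of multipole classes (of `b`; the block is `j`-free) has `v ≥ [p ≤ d] − N_p = refund − N_p`.  With `SingleRowLaw`, the mixed
pairs (multipole `x`, single-pole `y`: `v(B_{xy}) ≥ 3 + E_x + {0, −s_y}`, never below target) and THEOREM V this is (CV) in the window; its content is
the finite list of two-point digit identities of REPORT-gen2-g8 §3.3–§3.4 (first digit PROVED in closed form modulo the one-shape lemma). -/
@[conjecture] def MultiBlockLaw : Prop :=
  ∀ (b : ℕ → ℤ) (j p : ℕ), InPolytope b → 1 ≤ j → j ≤ 7 → InPolytope (shift b j) →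
    p.Prime → 5 ≤ p → (p : ℤ) ≤ b 0 → (b 0 + 2 : ℤ) < (p : ℤ) ^ 2 →
      (∑ x ∈ multipoleClasses b p, ∑ y ∈ multipoleClasses b p,
          (classK (shift b j) p x * classV b p y - classK b p x * classV (shift b j) p y)) ≠ 0 →
        refund b p - pairFloors b p ≤
          padicValRat p (∑ x ∈ multipoleClasses b p, ∑ y ∈ multipoleClasses b p,
            (classK (shift b j) p x * classV b p y - classK b p x * classV (shift b j) p y))

/-! ### §3e (NEW, g8) THE CASORATIAN CLASS BOUND and (CV) ON THE RECORD RAY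

(REPORT-gen2-g8 §3.7.)  Summing the `𝒦`-bracket by ROWS, `B = Σ_x (𝒦_x(b⁺)·V(b) − 𝒦_x(b)·V(b⁺))`, and bounding every factor termwise gives a
DIGIT-FREE lower bound that is PROVED on paper from Theorem A, Theorem A′, `ZeroEvaluation`, `v_p(H_q^{(σ)}) = 0 (q < p)`, the divisibilities
`p² ∣ g_0`, `p ∣ g_o − [o=2]`, `MomentVanishing`/`MomentIntegral` and `casoratian_split`:
  **`v_p(Cas_j(b)) ≥ LB(b,p) := VB(b,p) + min{ 1 [∃ single-pole class], 3 + E_x [x multipole], 0 [p > d] }`**,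
  `VB(b,p) := min over pole classes y of ν_y`, `ν_y = E_y` (multipole), `ν_y = max(E_y,0)` (single pole at level 0, or every class point
  below the pole a zero), `ν_y = E_y` (other single-pole classes).
Exhaustive check (lbcheck.py, every polytope vector n ≤ 12, every window prime and `p = b₀+1`, every admissible `j`): `v(Cas_j) ≥ LB` in 78,472 /
78,472 (equality 37,272); `LB ≥ [p≤d] − N_p` in 61,073 of them (the other 17,399 are the cancellation regime of §3.2–§3.4).
**On the Brown–Zudilin record ray `b = n·(41;17,16,15,14,13,12,11)` the class bound dominates the (CV) law for EVERY `n ≥ 1` and every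
`5 ≤ p ≤ 41n`** (`RecordRayDominance`; PROVED on paper by a scale-free argument: in the coordinates `θ = p/n`, `u = x₀/n` the class data are
constant on the faces of a finite line arrangement for `θ > 4.9` (rayproof.py evaluates all faces exactly: minimum slack 0 at `θ = 29/2`), and for
`θ ≤ 173/35` point counting gives slack `≥ 173/θ − 35 ≥ 0`; finite sanity recordray3.py n ≤ 200), hence (CV) holds on the whole record ray in the
window (`recordRayCV_of`, PROVED here from the two named statements) — no digit cancellation occurs on the ray, and `LB` is sharp there
(`v(Cas_j) = LB` for most `(n,p)`, e.g. `n = 1`: `LB = (−13,−9,−7,−1,1,1,0,0,0,0)` at `p = 7,…,41` against the (CV) law `(−29,−16,−11,−1,1,1,0,…)`). -/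

/-- A single-pole class is TAME if its pole `q` is at level 0 (`q < p`, so `H_q^{(σ)}` is `p`-integral) or every class point below `q` is a zero
(`ZeroEvaluation`).  (Boolean test.) -/
def tameSingle (b : ℕ → ℤ) (p x : ℕ) : Bool :=
  decide (∃ q ∈ classSet b p x, netExp b q < 0 ∧ (q < p ∨ ∀ s ∈ classSet b p x, s < q → 0 < netExp b s))

/-- `ν_x`: the termwise lower bound for `v_p(V_x)` of a pole class (`E_x`, improved to `max(E_x,0)` for tame single-pole classes). -/
def classNu (b : ℕ → ℤ) (p x : ℕ) : ℤ :=
  if classPoleCount b p x = 1 ∧ tameSingle b p x = true then max (classExp b p x) 0 else classExp b p x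

/-- `VB(b,p)`: the minimum of `ν_x` over the pole classes (`none` if there is no pole class). -/
def vbMin (b : ℕ → ℤ) (p : ℕ) : Option ℤ :=
  (((List.range p).filter fun x => 1 ≤ classPoleCount b p x).map (classNu b p)).min?

/-- The row term: `min{ 1 [some class has exactly one pole], 3 + E_x [x multipole], 0 [p > d] }` (`none` if empty). -/
def rowMin (b : ℕ → ℤ) (p : ℕ) : Option ℤ :=
  (((List.range p).filterMap fun x =>
      if classPoleCount b p x = 1 then some 1
      else if 2 ≤ classPoleCount b p x then some (3 + classExp b p x) else none)
    ++ (if dOf b < (p : ℤ) then [0] else [])).min?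

/-- **The Casoratian class bound `LB(b,p) = VB + rowMin`** (`0` when there is no pole class, in which case `Cas_j = 0`). -/
def casLB (b : ℕ → ℤ) (p : ℕ) : ℤ :=
  match vbMin b p, rowMin b p with
  | some v, some r => v + r
  | _, _ => 0

/-- **ν-BOUND (PROVED on paper: `ClassVBound` + Theorem A′ + `ZeroEvaluation` + `v_p(H_q^{(σ)}) = 0` for `q < p`)**: `v_p(V_x) ≥ ν_x`. -/
@[conjecture] def ClassNuBound : Prop :=
  ∀ (b : ℕ → ℤ) (p x : ℕ), InPolytope b → p.Prime → 5 ≤ p → (b 0 + 2 : ℤ) < (p : ℤ) ^ 2 →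
    x < p → 1 ≤ classPoleCount b p x → classV b p x ≠ 0 → classNu b p x ≤ padicValRat p (classV b p x)

/-- **THEOREM LB — THE CASORATIAN CLASS BOUND (g8 §3.7; PROVED on paper modulo Theorems A/A′/ZeroEvaluation and the moment lemmas; exhaustive
check 78,472 (b,p,j), equality in 37,272)**: `v_p(Cas_j(b)) ≥ LB(b,p)` for every window prime. Digit-free. -/
@[conjecture] def CasoratianClassBound : Prop :=
  ∀ (b : ℕ → ℤ) (j p : ℕ), InPolytope b → 1 ≤ j → j ≤ 7 → InPolytope (shift b j) →
    p.Prime → 5 ≤ p → (b 0 + 2 : ℤ) < (p : ℤ) ^ 2 → casoratian b j ≠ 0 → casLB b p ≤ padicValRat p (casoratian b j)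

/-- The record ray `b(n) = n·(41; 17,16,15,14,13,12,11)` — the dual parameters `bOfA (n • recordVec)` of Brown–Zudilin's record direction
(see `bRec_eq_bOfA`), `d = 25n`. -/
def bRec (n : ℕ) : ℕ → ℤ := fun i => (n : ℤ) * (([41, 17, 16, 15, 14, 13, 12, 11] : List ℤ).getD i 0)

section Record

open Literature.NumberTheory.Irrationality.BrownZudilin2022 (bOfA recordVec)
open Summit.KontsevichZagierPeriods.Zeta5Search.WedgeDictionary (bOfA_nsmul)

/-- `bRec n` is the dual parameter vector `b(n·a)` of `n` times Brown–Zudilin's record direction `a = (8,16,10,15,12,16,18,13)`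
(so `RecordRayCV` below is literally (CV) on the ray of `record_ray_prime_dvd_coeffW`). -/
theorem bRec_eq_bOfA (n : ℕ) : bOfA (fun i => (n : ℤ) * recordVec i) = bRec n := by
  funext j
  rw [bOfA_nsmul]
  match j with
  | 0 => have h : bOfA recordVec 0 = 41 := by decide
         simp [h, bRec]
  | 1 => have h : bOfA recordVec 1 = 17 := by decide
         simp [h, bRec]
  | 2 => have h : bOfA recordVec 2 = 16 := by decide
         simp [h, bRec]
  | 3 => have h : bOfA recordVec 3 = 15 := by decide
         simp [h, bRec]
  | 4 => have h : bOfA recordVec 4 = 14 := by decide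
         simp [h, bRec]
  | 5 => have h : bOfA recordVec 5 = 13 := by decide
         simp [h, bRec]
  | 6 => have h : bOfA recordVec 6 = 12 := by decide
         simp [h, bRec]
  | 7 => have h : bOfA recordVec 7 = 11 := by decide
         simp [h, bRec]
  | k + 8 => simp [bOfA, bRec]

end Record

/-- **RECORD-RAY DOMINANCE (g8 §3.7; PROVED on paper, scale-free certificate rayproof.py + counting for `p ≤ 4.94n`)**: on the record ray the class bound
dominates the (CV) law at every prime `5 ≤ p ≤ 41n` (all `n ≥ 1`). Decidable for each `n`; `#guard`ed below for `n ≤ 3`. -/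
@[conjecture] def RecordRayDominance : Prop :=
  ∀ (n p : ℕ), 1 ≤ n → p.Prime → 5 ≤ p → p ≤ 41 * n → refund (bRec n) p - pairFloors (bRec n) p ≤ casLB (bRec n) p

/-- **(CV) ON THE RECORD RAY** (all `n ≥ 1`, all window primes `5 ≤ p ≤ 41n`, `p² > 41n + 2`, all `j`); PROVED below from
`CasoratianClassBound` and `RecordRayDominance` (`recordRayCV_of`). -/
@[conjecture] def RecordRayCV : Prop :=
  ∀ (n j p : ℕ), 1 ≤ n → 1 ≤ j → j ≤ 7 → p.Prime → 5 ≤ p → p ≤ 41 * n → (41 * n + 2 : ℤ) < (p : ℤ) ^ 2 →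
    casoratian (bRec n) j ≠ 0 → refund (bRec n) p - pairFloors (bRec n) p ≤ padicValRat p (casoratian (bRec n) j)

/-- The record ray lies in the polytope. -/
theorem inPolytope_bRec (n : ℕ) : InPolytope (bRec n) := by
  refine ⟨⟨?_, ?_⟩, ?_, ?_⟩
  · simp [bRec]
  · intro j hj
    simp only [Finset.mem_range] at hj
    interval_cases j <;> simp [bRec] <;> omega
  · intro i hi
    simp only [Finset.mem_range] at hi
    interval_cases i <;> simp [bRec] <;> omega
  · simp [bRec, Finset.sum_range_succ]; omega

/-- Its contiguous shifts stay in the polytope (`n ≥ 1`). -/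
theorem inPolytope_shift_bRec (n j : ℕ) (hn : 1 ≤ n) (hj1 : 1 ≤ j) (hj7 : j ≤ 7) : InPolytope (shift (bRec n) j) := by
  interval_cases j <;>
  · refine ⟨⟨?_, ?_⟩, ?_, ?_⟩
    · simp [shift, bRec]
    · intro i hi
      simp only [Finset.mem_range] at hi
      interval_cases i <;> simp [shift, bRec, Function.update] <;> omega
    · intro i hi
      simp only [Finset.mem_range] at hi
      interval_cases i <;> simp [shift, bRec, Function.update] <;> omega
    · simp [shift, bRec, Function.update, Finset.sum_range_succ]; omega

/-- **(CV) on the record ray follows from the class bound and the dominance** (PROVED). -/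
theorem recordRayCV_of (hLB : CasoratianClassBound) (hD : RecordRayDominance) : RecordRayCV := by
  intro n j p hn hj1 hj7 hp h5 hpn hwin hcas
  have hwin' : (bRec n 0 + 2 : ℤ) < (p : ℤ) ^ 2 := by simpa [bRec, mul_comm] using hwin
  exact le_trans (hD n p hn hp h5 hpn) (hLB (bRec n) j p (inPolytope_bRec n) hj1 hj7 (inPolytope_shift_bRec n j hn hj1 hj7) hp h5 hwin' hcas)

/-! ### §3d Cross-checks of the §3b/§3e data (`#guard`, computable defs only) -/

/-- Worked vector `(15,6,6,5,4,2,1,1)` (= `bEx0` of `ClusterValuationChecks`). -/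
def bEx0' : ℕ → ℤ := fun i => (([15, 6, 6, 5, 4, 2, 1, 1] : List ℤ).getD i 0)
/-- Worked vector `(20,10,8,7,5,3,3,3)` (= `bEx1` of `ClusterValuationChecks`). -/
def bEx1' : ℕ → ℤ := fun i => (([20, 10, 8, 7, 5, 3, 3, 3] : List ℤ).getD i 0)
/-- Worked vector `(13,4,3,3,2,2,1,0)` (= `bEx2` of `ClusterValuationChecks`). -/
def bEx2' : ℕ → ℤ := fun i => (([13, 4, 3, 3, 2, 2, 1, 0] : List ℤ).getD i 0)
/-- `b = (31,15,14,13,12,3,0,0)`: at `p = 23` the classes of `3` and `5 ≡ 31 − 3` are extremal (two double poles, `E = −4 = −(N_p+1)`, `N_p = 3`);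
at `p = 29` the classes of `0` and `2` are extremal (two simple poles, `N_p = 1`). -/
def bEx3 : ℕ → ℤ := fun i => (([31, 15, 14, 13, 12, 3, 0, 0] : List ℤ).getD i 0)

#guard pairFloors bEx3 23 == 3 && classExp bEx3 23 3 == -4 && classPoleCount bEx3 23 3 == 2 && (classSet bEx3 23 3).card == 2 &&
  conjClass bEx3 23 3 == 5 && classExp bEx3 23 5 == -4 && decide (∀ q ∈ classSet bEx3 23 3, netExp bEx3 q = -2)
#guard pairFloors bEx3 29 == 1 && classExp bEx3 29 0 == -2 && conjClass bEx3 29 0 == 2 && classExp bEx3 29 2 == -2 &&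
  (classSet bEx3 29 0).card == 2 && decide (∀ q ∈ classSet bEx3 29 0, netExp bEx3 q = -1)
-- `ClassExpLowerBound` on all classes of the example vectors at their window primes; extremal classes occur only at (bEx1',13), (bEx3,23), (bEx3,29)
#guard [(bEx0', 5), (bEx0', 7), (bEx0', 11), (bEx0', 13), (bEx1', 5), (bEx1', 7), (bEx1', 11), (bEx1', 13), (bEx1', 17), (bEx1', 19), (bEx2', 5), (bEx2', 7),
    (bEx2', 11), (bEx2', 13), (bEx3, 7), (bEx3, 11), (bEx3, 13), (bEx3, 17), (bEx3, 19), (bEx3, 23), (bEx3, 29), (bEx3, 31)].all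
  fun bp => (List.range bp.2).all fun x =>
    decide (classPoleCount bp.1 bp.2 x < 2) || decide (-(pairFloors bp.1 bp.2 + 1) ≤ classExp bp.1 bp.2 x)
#guard ([(bEx0', 5), (bEx0', 7), (bEx0', 11), (bEx0', 13), (bEx1', 5), (bEx1', 7), (bEx1', 11), (bEx1', 13), (bEx1', 17), (bEx1', 19), (bEx2', 5), (bEx2', 7),
    (bEx2', 11), (bEx2', 13), (bEx3, 7), (bEx3, 11), (bEx3, 13), (bEx3, 17), (bEx3, 19), (bEx3, 23), (bEx3, 29), (bEx3, 31)].map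
  fun bp => ((List.range bp.2).filter fun x =>
    decide (2 ≤ classPoleCount bp.1 bp.2 x) && decide (classExp bp.1 bp.2 x = -(pairFloors bp.1 bp.2 + 1))).length) ==
  [0, 0, 0, 0, 0, 0, 0, 2, 0, 0, 0, 0, 0, 0, 0, 0, 0, 0, 0, 2, 2, 0]


-- §3e: the class bound LB vs the (CV) law on the record ray n = 1, 2 (g8/raylb.py: v_p(Cas_j) = LB in 182/196 exact instances; exceptions n=2, p=17 (LB+2), p=29 (LB+1))
#guard [7, 11, 13, 17, 19, 23, 29, 31, 37, 41].map (casLB (bRec 1)) = [-13, -9, -7, -1, 1, 1, 0, 0, 0, 0]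
#guard [7, 11, 13, 17, 19, 23, 29, 31, 37, 41].map (fun p => refund (bRec 1) p - pairFloors (bRec 1) p) = [-29, -16, -11, -1, 1, 1, 0, 0, 0, 0]
#guard [11, 13, 17, 19, 23, 29, 31, 37, 41, 43, 47, 53, 59, 61, 67, 71, 73, 79].map (casLB (bRec 2))
    = [-17, -15, -13, -11, -7, -5, -3, 1, 1, 1, 1, 0, 0, 0, 0, 0, 0, 0]
#guard [11, 13, 17, 19, 23, 29, 31, 37, 41, 43, 47, 53, 59, 61, 67, 71, 73, 79].all
    (fun p => refund (bRec 2) p - pairFloors (bRec 2) p ≤ casLB (bRec 2) p)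
#guard ((List.range 124).filter (fun p => p.Prime ∧ 5 ≤ p)).all (fun p => refund (bRec 3) p - pairFloors (bRec 3) p ≤ casLB (bRec 3) p)
-- LB on the worked vectors (lbcheck.py values); bEx3 is in the cancellation regime (LB < law at p = 17, 19, 23, 29)
#guard [5, 7, 11, 13].map (casLB bEx0') = [-17, -13, -3, 0]
#guard [5, 7, 11, 13, 17, 19].map (casLB bEx1') = [-17, -15, -7, -5, 1, 1]
#guard [7, 11, 13, 17, 19, 23, 29, 31].map (casLB bEx3) = [-21, -17, -15, -9, -5, -5, -1, 0]
#guard [7, 11, 13, 17, 19, 23, 29, 31].map (fun p => refund bEx3 p - pairFloors bEx3 p) = [-34, -17, -17, -8, -4, -2, 0, 0]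

end Summit.KontsevichZagierPeriods.Zeta5Search.ClusterValuation
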